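import Summits.AtomisticToContinuum.FouriersLaw.Theorems.VanishingNoiseTransferVanishingNoiseBoundJumpPerturbationSemigroup
import Summits.AtomisticToContinuum.FouriersLaw.Theorems.VanishingNoiseTransferVanishingNoiseBoundJumpPerturbationResolvent
import Summits.AtomisticToContinuum.FouriersLaw.Theorems.VanishingNoiseTransferVanishingNoiseBoundFlipInvariantSteady
import Literature.MathematicalPhysics.KineticTheory.VelocityFlipEmbeddedChain

/-!
# The flip semigroup of the pinned anharmonic chain (transition kernels of `L + εS`)
(brick for crux stmt-AtomisticToContinuum-11976 `VanishingNoiseTransfer.VanishingNoiseBound`, line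
`fekete-usc-one-length`, stub S3 `stub_noisyPositiveConductance`; worker file, wave 2)

The residual content of S3 (finite-volume Green–Kubo positivity for `L + εS`) is semigroup theory of the
flip-noisy chain, and the tree had no Markov semigroup for `L + εS`. This file delivers it
(`exists_flipSemigroup`): for `pinnedChain ω₂ lam β γ` (`ω₂ > 0`, `lam, β, γ ≥ 0`), `N ≥ 1`,
`T_L, T_R ≥ 0` and every flip rate `ε > 0`, a family of MARKOV kernels `V_t` (`t ≥ 0`) on phase space
with `V_0 = id`, Chapman–Kolmogorov `V_{s+t} = V_t ∘ₖ V_s`, joint measurability, the DOMINATION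
`V_t(z,·) ≥ e^{-Nεt} P_t(z,·)` by the flip-free transition kernels (every small set / minorisation of
`P_t` passes to `V_t`), and the RESOLVENT IDENTITY
`∫ Exp_a(dt) ∫ (L f + εS f) dV_t(z,·) = a (∫ Exp_a(dt) ∫ f dV_t(z,·) - f z)` (`a > 0`, `f ∈ C_c^∞`) — the
Laplace transform in time of the Dynkin identity for the generator `L + εS`
(`OscillatorChain.flipGenerator`). Construction: the jump perturbation (Dyson–Phillips expansion,
files `…JumpPerturbation{Core,Mass,CK,Semigroup,Resolvent}.lean`) of the flip-free transition semigroup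
`pinnedChainSemigroup` (its time-extended kernel `timeKernel`) by the uniform single-site flip
`Q = flipKernel N` at rate `Nε`, using `L f + Nε(Qf - f) = L f + εS f` (`generator_add_flipKernel`).
Consequence (`isFlipSteadyState_of_invariant_of_resolvent`): every `V`-invariant probability measure
with integrable bond currents is a weak flip steady state (`OscillatorChain.IsFlipSteadyState`), which
is how uniqueness of the weak flip steady state (the frame of S3) will identify it with the invariant
measure of `V`.

No definitions (the semigroup is delivered existentially, like the tree's CEHR-2018 packaging of the
flip-free semigroup). Registered sub-goal: `helper_flipSemigroupExists`. References: Bernardin–Olla 2011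
(J. Stat. Phys. 145) §2.1; Ethier–Kurtz 1986, Ch. 4 §10; folklore.
-/

noncomputable section

namespace Summit.AtomisticToContinuum.FouriersLaw.Theorems.VanishingNoiseBound

open MeasureTheory ProbabilityTheory Filter Topology Set Function
open scoped NNReal ENNReal ContDiff
open Literature.MathematicalPhysics.KineticTheory.HeatConduction
open Literature.MathematicalPhysics.KineticTheory

/-! ### The flip semigroup of the pinned anharmonic chain -/

section Flip

variable {N : ℕ}

/-- Chapman–Kolmogorov for the time-extended kernel of a Langevin-chain semigroup, in the integrated
form consumed by the jump-perturbation files (`hKadd`). [folklore] -/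
theorem lintegral_timeKernel_add {P : OscillatorChain} {T_L T_R : ℝ} (S : LangevinChainSemigroup P N T_L T_R)
    {s t : ℝ} (hs : 0 ≤ s) (ht : 0 ≤ t) (x : PhaseSpace N) {f : PhaseSpace N → ℝ≥0∞} (hf : Measurable f) :
    ∫⁻ z, f z ∂(S.timeKernel (s + t, x)) = ∫⁻ y, ∫⁻ z, f z ∂(S.timeKernel (t, y)) ∂(S.timeKernel (s, x)) := by
  simp only [LangevinChainSemigroup.timeKernel_apply]
  rw [Real.toNNReal_add hs ht, S.kernel_add, Kernel.lintegral_comp _ _ _ hf]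

/-- The Dynkin identity of a Langevin-chain semigroup, for its time-extended kernel and real times
`t ≥ 0` (the abstract Dynkin-pair hypothesis of the jump-perturbation files). [folklore] -/
theorem timeKernel_dynkin {P : OscillatorChain} {T_L T_R : ℝ} (S : LangevinChainSemigroup P N T_L T_R)
    {f : PhaseSpace N → ℝ} (hf : ContDiff ℝ ∞ f) (hfc : HasCompactSupport f) {t : ℝ} (ht : 0 ≤ t)
    (y : PhaseSpace N) :
    ∫ z, f z ∂(S.timeKernel (t, y)) - f y =
      ∫ s in (0:ℝ)..t, ∫ z, P.generator N T_L T_R f z ∂(S.timeKernel (s, y)) := by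
  simp only [LangevinChainSemigroup.timeKernel_apply]
  have h := S.dynkin f hf hfc t.toNNReal y
  rwa [Real.coe_toNNReal t ht] at h

/-- **The flip generator is `L + Nε(Q - 1)`** with `Q = flipKernel N` the uniform single-site flip:
`L f + Nε (∫ f dQ - f) = L f + ε ∑_i (f ∘ momentumFlip i - f) = flipGenerator f` (`N ≥ 1`). [folklore] -/
theorem generator_add_flipKernel (P : OscillatorChain) (hN : 0 < N) (T_L T_R ε : ℝ)
    (f : PhaseSpace N → ℝ) (y : PhaseSpace N) :
    P.generator N T_L T_R f y + (N * ε) * ((∫ z, f z ∂(flipKernel N y)) - f y) =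
      P.flipGenerator N T_L T_R ε f y := by
  rw [integral_flipKernel hN, P.flipGenerator_apply, Finset.sum_sub_distrib, Finset.sum_const,
    Finset.card_univ, Fintype.card_fin, nsmul_eq_mul]
  have hN' : (N : ℝ) ≠ 0 := Nat.cast_ne_zero.2 hN.ne'
  field_simp

variable {ω₂ lam β γ : ℝ}

/-- **The flip semigroup of the pinned anharmonic chain.** For `pinnedChain ω₂ lam β γ` (`ω₂ > 0`,
`lam, β, γ ≥ 0`), `N ≥ 1` sites, bath temperatures `T_L, T_R ≥ 0` and a flip rate `ε > 0` there is a
family of MARKOV kernels `V_t` (`t ≥ 0`) on phase space — the transition semigroup of the velocity-flip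
dynamics `L + εS` of Bernardin–Olla, realised as the jump perturbation (Dyson–Phillips expansion
`V_t = ∑_n U_n(t)`) of the flip-free transition semigroup `pinnedChainSemigroup` by the uniform flip
kernel `Q = flipKernel N` at rate `Nε` — such that:
(1) `V_0 = id`; (2) Chapman–Kolmogorov `V_{s+t} = V_t ∘ₖ V_s`; (3) `(t, z) ↦ V_t(z, ·)` is measurable;
(4) DOMINATION by the flip-free evolution, `V_t(z, ·) ≥ e^{-Nεt} P_t(z, ·)` (no flip in `[0, t]`; every
small set of `P_t` is small for `V_t`); (5) the RESOLVENT IDENTITY tying `V` to the generator `L + εS`: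
for every `a > 0`, `f ∈ C_c^∞` and `z`,
`∫ Exp_a(dt) ∫ (L f + ε S f) dV_t(z, ·) = a (∫ Exp_a(dt) ∫ f dV_t(z, ·) - f z)`,
i.e. `∫₀^∞ e^{-at} V_t (L_ε f) dt = a ∫₀^∞ e^{-at} V_t f dt - f` — the Laplace transform in `t` of the
Dynkin identity `V_t f - f = ∫₀ᵗ V_s(L_ε f) ds` (which it implies, both sides being continuous in `t`).
[Bernardin–Olla 2011, §2.1 (the dynamics `L + γS`); Ethier–Kurtz 1986, Ch. 4 §10 (Markov processes with
bounded jump perturbations); folklore] -/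
theorem exists_flipSemigroup (hω : 0 < ω₂) (hl : 0 ≤ lam) (hβ : 0 ≤ β) (hγ : 0 ≤ γ) (hN : 0 < N)
    {T_L T_R : ℝ} (hTL : 0 ≤ T_L) (hTR : 0 ≤ T_R) {ε : ℝ} (hε : 0 < ε) :
    ∃ V : ℝ≥0 → Kernel (PhaseSpace N) (PhaseSpace N),
      (∀ t, IsMarkovKernel (V t)) ∧ V 0 = Kernel.id ∧ (∀ s t, V (s + t) = V t ∘ₖ V s) ∧
      (Measurable fun p : ℝ≥0 × PhaseSpace N => V p.1 p.2) ∧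
      (∀ (t : ℝ≥0) (z : PhaseSpace N), ENNReal.ofReal (Real.exp (-(N * ε * t))) •
        (pinnedChain ω₂ lam β γ).transitionKernel N T_L T_R t z ≤ V t z) ∧
      (∀ a : ℝ, 0 < a → ∀ f : PhaseSpace N → ℝ, ContDiff ℝ ∞ f → HasCompactSupport f →
        ∀ z : PhaseSpace N,
          ∫ t, (∫ y, (pinnedChain ω₂ lam β γ).flipGenerator N T_L T_R ε f y ∂(V t.toNNReal z))
              ∂(expMeasure a) =
            a * ((∫ t, (∫ y, f y ∂(V t.toNNReal z)) ∂(expMeasure a)) - f z)) := by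
  set P := pinnedChain ω₂ lam β γ with hPdef
  set S := pinnedChainSemigroup hω hl hβ hγ hN hTL hTR with hSdef
  set K : Kernel (ℝ × PhaseSpace N) (PhaseSpace N) := S.timeKernel with hKdef
  set Q : Kernel (PhaseSpace N) (PhaseSpace N) := flipKernel N with hQdef
  have hr : 0 < (N : ℝ) * ε := by positivity
  haveI := isProbabilityMeasure_expMeasure hr
  have hKadd : ∀ s t : ℝ, 0 ≤ s → 0 ≤ t → ∀ (x : PhaseSpace N) (f : PhaseSpace N → ℝ≥0∞), Measurable f →
      ∫⁻ z, f z ∂(K (s + t, x)) = ∫⁻ y, ∫⁻ z, f z ∂(K (t, y)) ∂(K (s, x)) :=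
    fun s t hs ht x f hf => lintegral_timeKernel_add S hs ht x hf
  obtain ⟨U, hUfin, hU0, hUsucc⟩ := JumpPerturbation.exists_dysonPhillips K Q hr
  haveI := hUfin
  -- the perturbed kernels `V_t = ∑_n U_n(t)`
  obtain ⟨V, hV⟩ : ∃ V : ℝ≥0 → Kernel (PhaseSpace N) (PhaseSpace N),
      ∀ (t : ℝ≥0) (x : PhaseSpace N), V t x = Measure.sum fun n => U n ((t : ℝ), x) :=
    ⟨fun t => Kernel.sum fun n => (U n).comap (fun x => ((t : ℝ), x)) measurable_prodMk_left,
      fun t x => by simp only [Kernel.sum_apply, Kernel.comap_apply]⟩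
  -- no jump can have happened at time `0`
  have hUsucc0 : ∀ n x, U (n + 1) (0, x) = 0 := by
    intro n x
    have hFm : Measurable fun q : ℝ × PhaseSpace N => ∫⁻ y', ∫⁻ z, (1 : ℝ≥0∞) ∂(K (q.1, y')) ∂(Q q.2) :=
      JumpPerturbation.measurable_jumpObs K Q measurable_const
    have hm : Measurable fun s : ℝ =>
        ∫⁻ y, ∫⁻ y', ∫⁻ z, (1 : ℝ≥0∞) ∂(K (s, y')) ∂(Q y) ∂(U n (0 - s, x)) :=
      (JumpPerturbation.measurable_lintegral_shift (U n) 0 hFm).comp (measurable_id.prodMk measurable_const)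
    have hmass : U (n + 1) (0, x) univ = 0 := by
      rw [← lintegral_one, hUsucc n ((0 : ℝ), x) (fun _ => 1) measurable_const]
      dsimp only
      rw [JumpPerturbation.lintegral_expMeasure_indicator' _ measurableSet_Iio hm, Iio_inter_Ioi, Ioo_self]
      simp
    exact Measure.measure_univ_eq_zero.mp hmass
  have hU00 : ∀ x, U 0 (0, x) = Measure.dirac x := by
    intro x
    rw [hU0 ((0 : ℝ), x) le_rfl]
    simp [K, LangevinChainSemigroup.timeKernel_apply]
  -- joint measurability: `(t, x) ↦ V_t(x, ·)` is itself a (sum) kernel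
  obtain ⟨Vj, hVj⟩ : ∃ Vj : Kernel (ℝ≥0 × PhaseSpace N) (PhaseSpace N),
      ∀ p : ℝ≥0 × PhaseSpace N, Vj p = V p.1 p.2 :=
    ⟨Kernel.sum fun n => (U n).comap (fun p : ℝ≥0 × PhaseSpace N => ((p.1 : ℝ), p.2)) (by fun_prop),
      fun p => by rw [hV]; simp only [Kernel.sum_apply, Kernel.comap_apply]⟩
  have hmeas : Measurable fun p : ℝ≥0 × PhaseSpace N => V p.1 p.2 := by
    have : (fun p : ℝ≥0 × PhaseSpace N => V p.1 p.2) = ⇑Vj := funext fun p => (hVj p).symm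
    rw [this]
    exact Vj.measurable
  refine ⟨V, fun t => JumpPerturbation.isMarkovKernel_V K Q hr U hU0 hUsucc V hV t, ?_,
    fun s t => JumpPerturbation.V_add K Q hr hKadd U hU0 hUsucc V hV s t, hmeas, ?_, ?_⟩
  · -- (1) `V_0 = id`
    refine Kernel.ext fun x => ?_
    rw [hV, Kernel.id_apply, NNReal.coe_zero]
    refine Measure.ext fun s hs => ?_
    rw [Measure.sum_apply _ hs, tsum_eq_single 0 fun n hn => ?_, hU00 x]
    obtain ⟨m, rfl⟩ := Nat.exists_eq_succ_of_ne_zero hn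
    rw [hUsucc0 m x]
    rfl
  · -- (4) domination by the flip-free evolution
    intro t z
    have h := JumpPerturbation.smul_kernel_le_V K U hU0 V hV t z
    have hK : K ((t : ℝ), z) = P.transitionKernel N T_L T_R t z := by
      show S.kernel (t : ℝ).toNNReal z = _
      rw [Real.toNNReal_coe]
      rfl
    rwa [hK] at h
  · -- (5) the resolvent identity
    intro a ha f hf hfc z
    have hb : 0 < a + N * ε := by linarith
    haveI := isProbabilityMeasure_expMeasure ha
    haveI := isProbabilityMeasure_expMeasure hb
    -- the Neumann series of resolvent kernels
    obtain ⟨R, hR⟩ : ∃ R : Kernel (PhaseSpace N) (PhaseSpace N),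
        R = K ∘ₖ (Kernel.const (PhaseSpace N) (expMeasure (a + N * ε)) ×ₖ Kernel.id) := ⟨_, rfl⟩
    obtain ⟨W, hW0, hWsucc⟩ : ∃ W : ℕ → Kernel (PhaseSpace N) (PhaseSpace N),
        W 0 = R ∧ ∀ n, W (n + 1) = R ∘ₖ (Q ∘ₖ W n) :=
      ⟨fun n => Nat.rec R (fun _ w => R ∘ₖ (Q ∘ₖ w)) n, rfl, fun n => rfl⟩
    haveI hWm : ∀ n, IsMarkovKernel (W n) := JumpPerturbation.isMarkovKernel_W K Q hr ha R hR W hW0 hWsucc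
    haveI hWs : ∀ n, IsSFiniteKernel (W n) := fun n => by infer_instance
    obtain ⟨RQ, hRQ⟩ : ∃ RQ : Kernel (PhaseSpace N) (PhaseSpace N), ∀ x, RQ x = Measure.sum fun n =>
        ENNReal.ofReal (a / (a + N * ε) * (N * ε / (a + N * ε)) ^ n) • W n x := by
      refine ⟨Kernel.sum fun n => Kernel.withDensity (W n)
        (fun (_ : PhaseSpace N) (_ : PhaseSpace N) =>
          ENNReal.ofReal (a / (a + N * ε) * (N * ε / (a + N * ε)) ^ n)), fun x => ?_⟩
      simp only [Kernel.sum_apply]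
      congr 1
      funext n
      rw [Kernel.withDensity_apply (W n)
          (f := fun (_ : PhaseSpace N) (_ : PhaseSpace N) =>
            ENNReal.ofReal (a / (a + N * ε) * (N * ε / (a + N * ε)) ^ n)) measurable_const,
        withDensity_const]
    haveI := JumpPerturbation.isMarkovKernel_RQ K Q hr ha R hR W hW0 hWsucc RQ hRQ
    -- (i) the Laplace transform of `V` is `RQ`, as measures
    have hVt : ∀ t : ℝ, 0 < t → V t.toNNReal z = Measure.sum fun n => U n (t, z) := by
      intro t ht
      rw [hV, Real.coe_toNNReal t ht.le]
    have hlap : ∀ φ : PhaseSpace N → ℝ≥0∞, Measurable φ →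
        ∫⁻ t, ∫⁻ y, φ y ∂(V t.toNNReal z) ∂(expMeasure a) = ∫⁻ y, φ y ∂(RQ z) := by
      intro φ hφ
      have hm1 : ∀ n, Measurable fun t : ℝ => ∫⁻ y, φ y ∂(U n (t, z)) := fun n =>
        JumpPerturbation.measurable_lintegral_time (U n) z hφ
      -- measurability in `t` through kernels in the time variable
      have hm2 : Measurable fun t : ℝ => ∫⁻ y, φ y ∂(V t.toNNReal z) := by
        have h := hφ.lintegral_kernel (κ := Vj.comap (fun t : ℝ => (t.toNNReal, z)) (by fun_prop))
        simpa only [Kernel.comap_apply, hVj] using h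
      obtain ⟨Uz, hUz⟩ : ∃ Uz : Kernel ℝ (PhaseSpace N),
          ∀ t, ∫⁻ y, φ y ∂(Uz t) = ∑' n, ∫⁻ y, φ y ∂(U n (t, z)) :=
        ⟨Kernel.sum fun n => (U n).comap (fun t : ℝ => (t, z)) measurable_prodMk_right,
          fun t => by simp only [Kernel.sum_apply, Kernel.comap_apply, lintegral_sum_measure]⟩
      have hm3 : Measurable fun t : ℝ => ∑' n, ∫⁻ y, φ y ∂(U n (t, z)) := by
        have h := hφ.lintegral_kernel (κ := Uz)
        simpa only [hUz] using h
      rw [JumpPerturbation.lintegral_expMeasure a hm2]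
      have hpt : ∀ t ∈ Ioi (0:ℝ), ENNReal.ofReal (a * Real.exp (-(a * t))) * ∫⁻ y, φ y ∂(V t.toNNReal z) =
          ENNReal.ofReal (a * Real.exp (-(a * t))) * ∑' n, ∫⁻ y, φ y ∂(U n (t, z)) := by
        intro t ht
        rw [hVt t ht, lintegral_sum_measure]
      rw [setLIntegral_congr_fun measurableSet_Ioi hpt,
        ← JumpPerturbation.lintegral_expMeasure a hm3,
        lintegral_tsum fun n => (hm1 n).aemeasurable]
      have hn : ∀ n, ∫⁻ t, ∫⁻ y, φ y ∂(U n (t, z)) ∂(expMeasure a) =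
          ENNReal.ofReal (a / (a + N * ε) * (N * ε / (a + N * ε)) ^ n) * ∫⁻ y, φ y ∂(W n z) := fun n =>
        JumpPerturbation.lintegral_expMeasure_lintegral_U K Q hr U hU0 hUsucc ha R hR W hW0 hWsucc n z hφ
      simp_rw [hn]
      rw [hRQ z, lintegral_sum_measure]
      refine tsum_congr fun n => ?_
      rw [lintegral_smul_measure, smul_eq_mul]
    -- (ii) hence `∫ Exp_a(dt) ∫ h dV_t(z,·) = ∫ h dRQ(z)` for bounded measurable `h`
    obtain ⟨κ, hκ⟩ : ∃ κ : Kernel ℝ (PhaseSpace N), ∀ t, κ t = V t.toNNReal z :=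
      ⟨Vj.comap (fun t : ℝ => (t.toNNReal, z)) (by fun_prop), fun t => by
        simp only [Kernel.comap_apply, hVj]⟩
    have hbind : (κ ∘ₘ expMeasure a) = RQ z := by
      refine Measure.ext_of_lintegral _ fun φ hφ => ?_
      rw [Measure.lintegral_bind (Kernel.aemeasurable κ) hφ.aemeasurable]
      simp_rw [hκ]
      exact hlap φ hφ
    have htransfer : ∀ h : PhaseSpace N → ℝ, Measurable h → ∀ C : ℝ, (∀ y, ‖h y‖ ≤ C) →
        ∫ t, (∫ y, h y ∂(V t.toNNReal z)) ∂(expMeasure a) = ∫ y, h y ∂(RQ z) := by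
      intro h hm C hC
      have hint : Integrable h ((κ ∘ₖ Kernel.const Unit (expMeasure a)) ()) := by
        rw [← Measure.comp_eq_comp_const_apply, hbind]
        exact JumpPerturbation.integrable_of_norm_le hm hC
      calc ∫ t, (∫ y, h y ∂(V t.toNNReal z)) ∂(expMeasure a)
          = ∫ t, ∫ y, h y ∂(κ t) ∂(Kernel.const Unit (expMeasure a) ()) := by
            rw [Kernel.const_apply]; simp_rw [hκ]
        _ = ∫ y, h y ∂((κ ∘ₖ Kernel.const Unit (expMeasure a)) ()) := (Kernel.integral_comp hint).symm
        _ = ∫ y, h y ∂(RQ z) := by rw [← Measure.comp_eq_comp_const_apply, hbind]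
    -- (iii) the abstract resolvent identity for the Dynkin pair `(f, L f)`
    have hf2 : ContDiff ℝ 2 f := hf.of_le (by norm_cast)
    have hgc : Continuous (P.generator N T_L T_R f) :=
      P.continuous_generator (pinnedChain_contDiff_U ω₂ lam β γ) (pinnedChain_contDiff_V ω₂ lam β γ) N T_L T_R hf2
    obtain ⟨Cg, hCg⟩ := P.exists_bound_generator (pinnedChain_contDiff_U ω₂ lam β γ)
      (pinnedChain_contDiff_V ω₂ lam β γ) N T_L T_R hf2 hfc
    obtain ⟨Cf, hCf⟩ : ∃ C, ∀ x, ‖f x‖ ≤ C := hf.continuous.bounded_above_of_compact_support hfc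
    have hres := JumpPerturbation.integral_RQ_eq_of_dynkin K Q hr ha R hR W hW0 hWsucc RQ hRQ z
      hf.continuous.measurable hgc.measurable hCf hCg
      (fun t ht y => timeKernel_dynkin S hf hfc ht y)
    -- (iv) identify the generator and transfer back to `V`
    have hgen : (fun y => P.generator N T_L T_R f y + N * ε * ((∫ x, f x ∂(Q y)) - f y)) =
        P.flipGenerator N T_L T_R ε f := funext fun y => generator_add_flipKernel P hN T_L T_R ε f y
    rw [hgen] at hres
    have hLc : Continuous (P.flipGenerator N T_L T_R ε f) :=
      continuous_flipGenerator P (pinnedChain_contDiff_U ω₂ lam β γ) (pinnedChain_contDiff_V ω₂ lam β γ)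
        T_L T_R ε hf2
    obtain ⟨CL, hCL⟩ := exists_bound_flipGenerator P (pinnedChain_contDiff_U ω₂ lam β γ)
      (pinnedChain_contDiff_V ω₂ lam β γ) T_L T_R ε hf2 hfc
    rw [htransfer _ hLc.measurable CL hCL, htransfer _ hf.continuous.measurable Cf hCf]
    exact hres

/-- **Invariant probability measures of the flip semigroup are weak flip steady states** (resolvent
form of `isFlipSteadyState_of_invariant_of_flipDynkin`). Let `P` be an oscillator chain with `C¹`
potentials and `V_t` (`t ≥ 0`) a measurable family of Markov kernels satisfying, for some `a > 0`, the
resolvent identity `∫ Exp_a(dt) ∫ (L f + εS f) dV_t(z,·) = a (∫ Exp_a(dt) ∫ f dV_t(z,·) - f z)` on `C_c^∞`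
(conclusion (5) of `exists_flipSemigroup`). Then every probability measure `μ` with `μ V_t = μ` for all
`t`, under which the bond currents are integrable, satisfies `∫ (L + εS) f dμ = 0` on `C_c^∞`, i.e. is an
`OscillatorChain.IsFlipSteadyState` (integrate the identity against `μ`; Fubini and invariance turn both
time averages into `μ`-integrals). [folklore] -/
theorem isFlipSteadyState_of_invariant_of_resolvent (P : OscillatorChain) (hU : ContDiff ℝ 1 P.U)
    (hV : ContDiff ℝ 1 P.V) {T_L T_R ε : ℝ} (V : ℝ≥0 → Kernel (PhaseSpace N) (PhaseSpace N))
    [∀ t, IsMarkovKernel (V t)] (hmeas : Measurable fun p : ℝ≥0 × PhaseSpace N => V p.1 p.2)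
    {a : ℝ} (ha : 0 < a)
    (hres : ∀ f : PhaseSpace N → ℝ, ContDiff ℝ ∞ f → HasCompactSupport f → ∀ z : PhaseSpace N,
      ∫ t, (∫ y, P.flipGenerator N T_L T_R ε f y ∂(V t.toNNReal z)) ∂(expMeasure a) =
        a * ((∫ t, (∫ y, f y ∂(V t.toNNReal z)) ∂(expMeasure a)) - f z))
    {μ : Measure (PhaseSpace N)} [IsProbabilityMeasure μ] (hinv : ∀ t, Kernel.Invariant (V t) μ)
    (hj : ∀ i : Fin N, Integrable (P.bondCurrent N i) μ) :
    P.IsFlipSteadyState N T_L T_R ε μ := by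
  haveI := isProbabilityMeasure_expMeasure ha
  refine ⟨inferInstance, fun f hf hfc => ?_, hj⟩
  have hf2 : ContDiff ℝ 2 f := hf.of_le (by norm_cast)
  -- time average against `Exp_a` followed by `μ` of a bounded continuous observable is its `μ`-mean
  have hmean : ∀ {h : PhaseSpace N → ℝ}, Continuous h → ∀ {C : ℝ}, (∀ y, ‖h y‖ ≤ C) →
      ∫ z, (∫ t, (∫ y, h y ∂(V t.toNNReal z)) ∂(expMeasure a)) ∂μ = ∫ z, h z ∂μ := by
    intro h hh C hC
    have hsm := stronglyMeasurable_integral_kernel_uncurry V hmeas hh.stronglyMeasurable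
    have hb : ∀ p : PhaseSpace N × ℝ, ‖∫ y, h y ∂(V p.2.toNNReal p.1)‖ ≤ C := fun p =>
      (norm_integral_le_of_norm_le_const (Eventually.of_forall hC)).trans (by simp)
    have hint : Integrable (Function.uncurry fun (z : PhaseSpace N) (t : ℝ) => ∫ y, h y ∂(V t.toNNReal z))
        (μ.prod (expMeasure a)) :=
      (integrable_const C).mono' hsm.aestronglyMeasurable (Eventually.of_forall fun p => hb p)
    rw [integral_integral_swap hint]
    have hin : ∀ t : ℝ, ∫ z, ∫ y, h y ∂(V t.toNNReal z) ∂μ = ∫ z, h z ∂μ := fun t =>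
      integral_kernel_invariant V (hinv _)
        ((integrable_const C).mono' hh.aestronglyMeasurable (Eventually.of_forall hC))
    simp_rw [hin]
    rw [integral_const, probReal_univ, one_smul]
  obtain ⟨CL, hCL⟩ := exists_bound_flipGenerator P hU hV T_L T_R ε hf2 hfc
  obtain ⟨Cf, hCf⟩ : ∃ C, ∀ x, ‖f x‖ ≤ C := hf.continuous.bounded_above_of_compact_support hfc
  have h1 := hmean (continuous_flipGenerator P hU hV T_L T_R ε hf2) hCL
  have h2 := hmean hf.continuous hCf
  have h3 : ∫ z, (∫ t, (∫ y, P.flipGenerator N T_L T_R ε f y ∂(V t.toNNReal z)) ∂(expMeasure a)) ∂μ =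
      ∫ z, a * ((∫ t, (∫ y, f y ∂(V t.toNNReal z)) ∂(expMeasure a)) - f z) ∂μ :=
    integral_congr_ae (Eventually.of_forall fun z => hres f hf hfc z)
  have hFi : Integrable (fun z => ∫ t, (∫ y, f y ∂(V t.toNNReal z)) ∂(expMeasure a)) μ := by
    have hsm := stronglyMeasurable_integral_kernel_uncurry V hmeas hf.continuous.stronglyMeasurable
    have hb : ∀ p : PhaseSpace N × ℝ, ‖∫ y, f y ∂(V p.2.toNNReal p.1)‖ ≤ Cf := fun p =>
      (norm_integral_le_of_norm_le_const (Eventually.of_forall hCf)).trans (by simp)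
    have hint : Integrable (Function.uncurry fun (z : PhaseSpace N) (t : ℝ) => ∫ y, f y ∂(V t.toNNReal z))
        (μ.prod (expMeasure a)) :=
      (integrable_const Cf).mono' hsm.aestronglyMeasurable (Eventually.of_forall fun p => hb p)
    exact hint.integral_prod_left
  have hfi : Integrable f μ :=
    (integrable_const Cf).mono' hf.continuous.aestronglyMeasurable (Eventually.of_forall hCf)
  rw [h1, integral_const_mul, integral_sub hFi hfi, h2, sub_self, mul_zero] at h3
  exact h3

/-- **Registered sub-goal `helper_flipSemigroupExists`** of stmt-AtomisticToContinuum-11976 (brick for stub S3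
`stub_noisyPositiveConductance`): `exists_flipSemigroup`, fully quantified and notation-free. [folklore] -/
theorem helper_flipSemigroupExists : ∀ (ω₂ lam β γ : ℝ), 0 < ω₂ → 0 ≤ lam → 0 ≤ β → 0 ≤ γ → ∀ (N : ℕ), 0 < N → ∀ (T_L T_R : ℝ), 0 ≤ T_L → 0 ≤ T_R → ∀ (ε : ℝ), 0 < ε → ∃ V : NNReal → ProbabilityTheory.Kernel (Literature.MathematicalPhysics.KineticTheory.HeatConduction.PhaseSpace N) (Literature.MathematicalPhysics.KineticTheory.HeatConduction.PhaseSpace N), (∀ t, ProbabilityTheory.IsMarkovKernel (V t)) ∧ V 0 = ProbabilityTheory.Kernel.id ∧ (∀ s t, V (s + t) = ProbabilityTheory.Kernel.comp (V t) (V s)) ∧ (Measurable fun p : NNReal × Literature.MathematicalPhysics.KineticTheory.HeatConduction.PhaseSpace N => V p.1 p.2) ∧ (∀ (t : NNReal) (z : Literature.MathematicalPhysics.KineticTheory.HeatConduction.PhaseSpace N), ENNReal.ofReal (Real.exp (-((N : ℝ) * ε * (t : ℝ)))) • (Literature.MathematicalPhysics.KineticTheory.HeatConduction.pinnedChain ω₂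 lam β γ).transitionKernel N T_L T_R t z ≤ V t z) ∧ (∀ a : ℝ, 0 < a → ∀ f : Literature.MathematicalPhysics.KineticTheory.HeatConduction.PhaseSpace N → ℝ, ContDiff ℝ ((⊤ : ℕ∞) : WithTop ℕ∞) f → HasCompactSupport f → ∀ z : Literature.MathematicalPhysics.KineticTheory.HeatConduction.PhaseSpace N, MeasureTheory.integral (ProbabilityTheory.expMeasure a) (fun t => MeasureTheory.integral (V t.toNNReal z) (fun y => (Literature.MathematicalPhysics.KineticTheory.HeatConduction.pinnedChain ω₂ lam β γ).flipGenerator N T_L T_R ε f y)) = a * (MeasureTheory.integral (ProbabilityTheory.expMeasure a) (fun t => MeasureTheory.integral (V t.toNNReal z) (fun y => f y)) - f z)) :=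
  fun _ _ _ _ hω hl hβ hγ _ hN _ _ hTL hTR _ hε => exists_flipSemigroup hω hl hβ hγ hN hTL hTR hε

end Flip

end Summit.AtomisticToContinuum.FouriersLaw.Theorems.VanishingNoiseBound

end
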